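import Summits.CriticalPhenomena.PercolationContinuityZ3.Theorems.PercNearOneGluingAdditiveGluingTBlockCertificate
import Summits.CriticalPhenomena.PercolationContinuityZ3.Theorems.PercNearOneGluingAdditiveGluingGoodStep24Engine
import HarnessLib

/-! # Crux `PercNearOneGluing.AdditiveGluing` (stmt-CriticalPhenomena-4576) — Kozma–Nitzan Thms 4–5 for GLUED BLOCKS in the crux's additive
# (T-) form: the cost-free classes of the V⁺ recursion (depth prover `png-dp-vplus`, seat (b) V⁺-form)

Support file (`--supports stmt-CriticalPhenomena-4576`); no definitions, no named facts.  Companion of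
`…AdditiveGluingTBlockCertificate.lean` (`T_block_certificate`: one level of the V⁺ recursion for a glued block at its Question-9 designation).

`μ_{u/S}` = bond percolation on `Fin n` with the block `S` glued, relays `A ∋ b`, `Disjoint S A`, `q_∅` = `u` with the stars of `S` killed,
`T_d^{p}(X) := μ_p(X ↮ A) + μ_p(X ↔ b) − μ_p(d ↔ b)`.

* `T_layer_null`, `T_layer_empty_of_mem`, `T_layer_weight_zero`: a layer containing a vertex the block cannot touch is null.
* `T_block_nonneg_of_noFree`, `additiveGluing_block_of_noFree`: if the block has no positive-weight pair to a non-relay vertex outside it,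
  then `T_e^{u/S}(S) ≥ 0` at its Question-9 designation `e`, hence the `AdditiveGluing` inequality for the glued block observer
  (Kozma–Nitzan **Thm 4 for blocks**).
* `T_block_nonneg_of_oneFree`, `additiveGluing_block_of_oneFree`: if the block's only non-relay neighbour is `x`, the `AdditiveGluing`
  inequality for the observer `x` in the star-killed weighting `q_∅` (fewer positive-degree vertices) implies it for the glued block
  (Kozma–Nitzan **Thm 5 for blocks**; the singleton layer `{x}` is the only relay-free layer of positive mass and `q_{{x}} = q_∅` — the
  COST-FREE step of the T-form recursion: switching the designation at a singleton layer is free).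
[cite: KozmaNitzan2024, §3.2 (Lemma 5 p. 13, Thms 4–5 pp. 12–14), Question 9 (p. 36)]
-/

namespace Summit.CriticalPhenomena.PercolationContinuityZ3.Theorems

open MeasureTheory Set
open Literature.Probability.LatticeModels (prodBernoulli)
open Literature.Probability.Percolation (BondConfig openConn openGraph)
open scoped BigOperators Classical

noncomputable section

section TBlockClasses

variable {n : ℕ}

/-- A layer containing a vertex `y ∉ S` to which the block has no positive-weight pair is NULL (the layer event requires an open
pair `s(v, y)`, `v ∈ S`, of weight `0`). [folklore] -/
theorem T_layer_null (u : Sym2 (Fin n) → unitInterval) (S N : Finset (Fin n)) (y : Fin n) (hyN : y ∈ N) (hyS : y ∉ S)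
    (hy : ∀ v ∈ S, (u s(v, y) : ℝ) = 0) :
    (prodBernoulli (fun e' : Sym2 (Fin n) => if (∀ z ∈ e', z ∈ S) ∧ ¬ e'.IsDiag then 1 else u e')).real
        {ω : BondConfig (Fin n) | ∀ z : Fin n, z ∈ N ↔ (z ∉ S ∧ ∃ o ∈ S, s(o, z) ∈ ω)} = 0 := by
  refine sigmaRec_null _ _ (S.image fun v => s(v, y)) ?_ ?_
  · intro e' he'
    obtain ⟨v, hvS, rfl⟩ := Finset.mem_image.1 he'
    have hnot : ¬ ((∀ z ∈ s(v, y), z ∈ S) ∧ ¬ (s(v, y)).IsDiag) := by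
      rintro ⟨hall, -⟩
      exact hyS (hall y (Sym2.mem_mk_right v y))
    rw [if_neg hnot]
    exact Subtype.ext (by exact_mod_cast hy v hvS)
  · intro ω hω
    obtain ⟨-, o, ho, hoy⟩ := (hω y).1 hyN
    refine ⟨s(o, y), Finset.mem_image.2 ⟨o, ho, rfl⟩, hoy⟩

/-- A layer meeting the block itself is EMPTY (a layer vertex lies outside `S` by definition). [folklore] -/
theorem T_layer_empty_of_mem (S N : Finset (Fin n)) (y : Fin n) (hyN : y ∈ N) (hyS : y ∈ S) :
    {ω : BondConfig (Fin n) | ∀ y : Fin n, y ∈ N ↔ (y ∉ S ∧ ∃ o ∈ S, s(o, y) ∈ ω)} = (∅ : Set (BondConfig (Fin n))) := by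
  ext ω
  simp only [Set.mem_setOf_eq, Set.mem_empty_iff_false, iff_false]
  intro h
  exact ((h y).1 hyN).1 hyS

/-- **Relay-free non-empty layers are null when the block has no free neighbour other than (possibly) `x`.**  If every positive-weight
pair from `S` to a non-relay vertex outside `S` ends at `x`, then a non-empty relay-free layer `N ≠ {x}` has `μ_{u/S}(L_N) = 0`. -/
theorem T_layer_weight_zero (u : Sym2 (Fin n) → unitInterval) (A S N : Finset (Fin n)) (x : Fin n)
    (hfree : ∀ v ∈ S, ∀ y : Fin n, y ∉ A → y ∉ S → y ≠ x → (u s(v, y) : ℝ) = 0)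
    (hN : N.Nonempty) (hNA : Disjoint N A) (hNx : N ≠ {x}) :
    (prodBernoulli (fun e' : Sym2 (Fin n) => if (∀ y ∈ e', y ∈ S) ∧ ¬ e'.IsDiag then 1 else u e')).real
        {ω : BondConfig (Fin n) | ∀ y : Fin n, y ∈ N ↔ (y ∉ S ∧ ∃ o ∈ S, s(o, y) ∈ ω)} = 0 := by
  -- a vertex `y ∈ N` with `y ≠ x`
  obtain ⟨y, hyN, hyx⟩ : ∃ y ∈ N, y ≠ x := by
    by_contra h
    push Not at h
    apply hNx
    obtain ⟨z, hz⟩ := hN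
    have hzx : z = x := h z hz
    ext w
    simp only [Finset.mem_singleton]
    exact ⟨fun hw => h w hw, fun hw => hw ▸ hzx ▸ hz⟩
  have hyA : y ∉ A := Finset.disjoint_left.1 hNA hyN
  by_cases hyS : y ∈ S
  · rw [T_layer_empty_of_mem S N y hyN hyS, measureReal_empty]
  · exact T_layer_null u S N y hyN hyS fun v hv => hfree v hv y hyA hyS hyx

/-- **Kozma–Nitzan Thm 4 for blocks, T-form.**  If the glued block `S` has NO positive-weight pair to a non-relay vertex outside `S`,
then at its Question-9 designation `e` (a minimiser of `μ_{q_∅}(· ↔ b)` over `A`), `T_e^{u/S}(S) ≥ 0`.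
[cite: KozmaNitzan2024, Thm 4 (pp. 12–14)] -/
theorem T_block_nonneg_of_noFree (u : Sym2 (Fin n) → unitInterval) (A S : Finset (Fin n)) (e b : Fin n)
    (hb : b ∈ A) (hSA : Disjoint S A) (he : e ∈ A)
    (hmin : ∀ a ∈ A,
      (prodBernoulli (fun e' : Sym2 (Fin n) => if (∃ y ∈ e', y ∈ S) then (0 : unitInterval) else u e')).real (openConn e b) ≤
        (prodBernoulli (fun e' : Sym2 (Fin n) => if (∃ y ∈ e', y ∈ S) then (0 : unitInterval) else u e')).real (openConn a b))
    (hfree : ∀ v ∈ S, ∀ y : Fin n, y ∉ A → y ∉ S → (u s(v, y) : ℝ) = 0) :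
    0 ≤ (prodBernoulli (fun e' : Sym2 (Fin n) => if (∀ y ∈ e', y ∈ S) ∧ ¬ e'.IsDiag then 1 else u e')).real
          (⋃ v ∈ S, ⋃ a ∈ A, openConn v a)ᶜ +
        (prodBernoulli (fun e' : Sym2 (Fin n) => if (∀ y ∈ e', y ∈ S) ∧ ¬ e'.IsDiag then 1 else u e')).real
          (⋃ v ∈ S, openConn v b) -
        (prodBernoulli (fun e' : Sym2 (Fin n) => if (∀ y ∈ e', y ∈ S) ∧ ¬ e'.IsDiag then 1 else u e')).real
          (openConn e b) := by
  have h := T_block_certificate u A S e b hb hSA he hmin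
  have hsum : ∑ N ∈ (Finset.univ : Finset (Finset (Fin n))).filter (fun N => N.Nonempty ∧ Disjoint N A),
        (prodBernoulli (fun e' : Sym2 (Fin n) => if (∀ y ∈ e', y ∈ S) ∧ ¬ e'.IsDiag then 1 else u e')).real
            {ω : BondConfig (Fin n) | ∀ y : Fin n, y ∈ N ↔ (y ∉ S ∧ ∃ o ∈ S, s(o, y) ∈ ω)} *
          ((prodBernoulli (fun e' : Sym2 (Fin n) =>
                if (∀ y ∈ e', y ∈ N) ∧ ¬ e'.IsDiag then 1 else if (∃ y ∈ e', y ∈ S) then 0 else u e')).real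
              (⋃ v ∈ N, ⋃ a ∈ A, openConn v a)ᶜ +
            (prodBernoulli (fun e' : Sym2 (Fin n) =>
                if (∀ y ∈ e', y ∈ N) ∧ ¬ e'.IsDiag then 1 else if (∃ y ∈ e', y ∈ S) then 0 else u e')).real
              (⋃ v ∈ N, openConn v b) -
            (prodBernoulli (fun e' : Sym2 (Fin n) =>
                if (∀ y ∈ e', y ∈ N) ∧ ¬ e'.IsDiag then 1 else if (∃ y ∈ e', y ∈ S) then 0 else u e')).real
              (openConn e b)) = 0 := by
    refine Finset.sum_eq_zero fun N hN => ?_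
    obtain ⟨hNne, hNA⟩ := (Finset.mem_filter.1 hN).2
    obtain ⟨y, hyN⟩ := hNne
    have hyA : y ∉ A := Finset.disjoint_left.1 hNA hyN
    have hw : (prodBernoulli (fun e' : Sym2 (Fin n) => if (∀ y ∈ e', y ∈ S) ∧ ¬ e'.IsDiag then 1 else u e')).real
        {ω : BondConfig (Fin n) | ∀ y : Fin n, y ∈ N ↔ (y ∉ S ∧ ∃ o ∈ S, s(o, y) ∈ ω)} = 0 := by
      by_cases hyS : y ∈ S
      · rw [T_layer_empty_of_mem S N y hyN hyS, measureReal_empty]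
      · exact T_layer_null u S N y hyN hyS fun v hv => hfree v hv y hyA hyS
    rw [hw, zero_mul]
  rw [hsum, add_zero] at h
  have h1 : (prodBernoulli (fun e' : Sym2 (Fin n) => if (∃ y ∈ e', y ∈ S) then (0 : unitInterval) else u e')).real (openConn e b) ≤ 1 := measureReal_le_one
  have h2 : 0 ≤ (prodBernoulli (fun e' : Sym2 (Fin n) => if (∀ y ∈ e', y ∈ S) ∧ ¬ e'.IsDiag then 1 else u e')).real
          {ω : BondConfig (Fin n) | ∀ y : Fin n, y ∈ (∅ : Finset (Fin n)) ↔ (y ∉ S ∧ ∃ o ∈ S, s(o, y) ∈ ω)} := measureReal_nonneg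
  nlinarith

/-- **`AdditiveGluing` for a glued block with no free neighbours** (Kozma–Nitzan Thm 4 for blocks, in the crux's additive form): if the
glued block `S` (`Disjoint S A`, `b ∈ A`) has no positive-weight pair to a non-relay vertex outside `S`, then for every `t ≥ 0` with
`μ_{u/S}(a ↔ b) ≥ 1 − t` on `A`:  `μ_{u/S}(S ↔ A) − t ≤ μ_{u/S}(S ↔ b)`. [cite: KozmaNitzan2024, Thm 4 (pp. 12–14)] -/
theorem additiveGluing_block_of_noFree (u : Sym2 (Fin n) → unitInterval) (A S : Finset (Fin n)) (b : Fin n)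
    (hb : b ∈ A) (hSA : Disjoint S A)
    (hfree : ∀ v ∈ S, ∀ y : Fin n, y ∉ A → y ∉ S → (u s(v, y) : ℝ) = 0) :
    ∀ t : ℝ, 0 ≤ t →
      (∀ a ∈ A, 1 - t ≤ (prodBernoulli (fun e' : Sym2 (Fin n) => if (∀ y ∈ e', y ∈ S) ∧ ¬ e'.IsDiag then 1 else u e')).real (openConn a b)) →
      (prodBernoulli (fun e' : Sym2 (Fin n) => if (∀ y ∈ e', y ∈ S) ∧ ¬ e'.IsDiag then 1 else u e')).real
          (⋃ v ∈ S, ⋃ a ∈ A, openConn v a) - t ≤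
        (prodBernoulli (fun e' : Sym2 (Fin n) => if (∀ y ∈ e', y ∈ S) ∧ ¬ e'.IsDiag then 1 else u e')).real
          (⋃ v ∈ S, openConn v b) := by
  intro t _ hA
  -- a Question-9 designation: a minimiser of the star-killed two-point function over `A`
  obtain ⟨e, he, hmin⟩ := Finset.exists_min_image A
    (fun a => (prodBernoulli (fun e' : Sym2 (Fin n) => if (∃ y ∈ e', y ∈ S) then (0 : unitInterval) else u e')).real (openConn a b)) ⟨b, hb⟩
  have hT := T_block_nonneg_of_noFree u A S e b hb hSA he hmin hfree
  have hc : (prodBernoulli (fun e' : Sym2 (Fin n) => if (∀ y ∈ e', y ∈ S) ∧ ¬ e'.IsDiag then 1 else u e')).real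
        (⋃ v ∈ S, ⋃ a ∈ A, openConn v a)ᶜ =
      1 - (prodBernoulli (fun e' : Sym2 (Fin n) => if (∀ y ∈ e', y ∈ S) ∧ ¬ e'.IsDiag then 1 else u e')).real
        (⋃ v ∈ S, ⋃ a ∈ A, openConn v a) := by
    rw [measureReal_compl (MeasurableSet.of_discrete), probReal_univ]
  -- the glued two-point function of `e` dominates the star-killed one?  Not needed: we only use `1 - t ≤ μ_{u/S}(e ↔ b)` and
  -- `μ_{u/S}(e ↔ b) ≥ ...`?  No — `T_e` already contains `μ_{u/S}(e ↔ b)`.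
  have hAe := hA e he
  rw [hc] at hT
  linarith

/-- Gluing a singleton layer changes nothing: `q_{{x}} = q_∅` (the star-killed weighting). [folklore] -/
theorem T_q_singleton (u : Sym2 (Fin n) → unitInterval) (S : Finset (Fin n)) (x : Fin n) :
    (fun e' : Sym2 (Fin n) =>
        if (∀ y ∈ e', y ∈ ({x} : Finset (Fin n))) ∧ ¬ e'.IsDiag then 1 else if (∃ y ∈ e', y ∈ S) then 0 else u e') =
      (fun e' : Sym2 (Fin n) => if (∃ y ∈ e', y ∈ S) then (0 : unitInterval) else u e') :=
  goodStep24_glue_singleton (fun e' : Sym2 (Fin n) => if (∃ y ∈ e', y ∈ S) then (0 : unitInterval) else u e') x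

/-- **Kozma–Nitzan Thm 5 for blocks, T-form (one free neighbour).**  Let the glued block `S` (`Disjoint S A`, `b ∈ A`) have all its
positive-weight pairs to non-relay vertices outside `S` ending at ONE vertex `x ∉ A ∪ S`, and let `e` be a Question-9 designation of
`S` (a minimiser of the star-killed two-point function `μ_{q_∅}(· ↔ b)` over `A`).  If the `AdditiveGluing` inequality holds for the
observer `x` in the star-killed weighting `q_∅` at the level `t = 1 − μ_{q_∅}(e ↔ b)`, i.e. `T_e^{q_∅}(x) ≥ 0`, then `T_e^{u/S}(S) ≥ 0`.
Proof: `T_block_certificate`; the only relay-free layer of positive mass is `{x}` (`T_layer_weight_zero`) and `q_{{x}} = q_∅`.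
[cite: KozmaNitzan2024, Thm 5 (pp. 13–14)] -/
theorem T_block_nonneg_of_oneFree (u : Sym2 (Fin n) → unitInterval) (A S : Finset (Fin n)) (e b x : Fin n)
    (hb : b ∈ A) (hSA : Disjoint S A) (he : e ∈ A)
    (hmin : ∀ a ∈ A,
      (prodBernoulli (fun e' : Sym2 (Fin n) => if (∃ y ∈ e', y ∈ S) then (0 : unitInterval) else u e')).real (openConn e b) ≤
        (prodBernoulli (fun e' : Sym2 (Fin n) => if (∃ y ∈ e', y ∈ S) then (0 : unitInterval) else u e')).real (openConn a b))
    (hfree : ∀ v ∈ S, ∀ y : Fin n, y ∉ A → y ∉ S → y ≠ x → (u s(v, y) : ℝ) = 0)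
    (hx : 0 ≤ (prodBernoulli (fun e' : Sym2 (Fin n) => if (∃ y ∈ e', y ∈ S) then (0 : unitInterval) else u e')).real (⋃ a ∈ A, openConn x a)ᶜ +
        (prodBernoulli (fun e' : Sym2 (Fin n) => if (∃ y ∈ e', y ∈ S) then (0 : unitInterval) else u e')).real (openConn x b) -
        (prodBernoulli (fun e' : Sym2 (Fin n) => if (∃ y ∈ e', y ∈ S) then (0 : unitInterval) else u e')).real (openConn e b)) :
    0 ≤ (prodBernoulli (fun e' : Sym2 (Fin n) => if (∀ y ∈ e', y ∈ S) ∧ ¬ e'.IsDiag then 1 else u e')).real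
          (⋃ v ∈ S, ⋃ a ∈ A, openConn v a)ᶜ +
        (prodBernoulli (fun e' : Sym2 (Fin n) => if (∀ y ∈ e', y ∈ S) ∧ ¬ e'.IsDiag then 1 else u e')).real
          (⋃ v ∈ S, openConn v b) -
        (prodBernoulli (fun e' : Sym2 (Fin n) => if (∀ y ∈ e', y ∈ S) ∧ ¬ e'.IsDiag then 1 else u e')).real
          (openConn e b) := by
  have h := T_block_certificate u A S e b hb hSA he hmin
  have hsum : 0 ≤ ∑ N ∈ (Finset.univ : Finset (Finset (Fin n))).filter (fun N => N.Nonempty ∧ Disjoint N A),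
        (prodBernoulli (fun e' : Sym2 (Fin n) => if (∀ y ∈ e', y ∈ S) ∧ ¬ e'.IsDiag then 1 else u e')).real
            {ω : BondConfig (Fin n) | ∀ y : Fin n, y ∈ N ↔ (y ∉ S ∧ ∃ o ∈ S, s(o, y) ∈ ω)} *
          ((prodBernoulli (fun e' : Sym2 (Fin n) =>
                if (∀ y ∈ e', y ∈ N) ∧ ¬ e'.IsDiag then 1 else if (∃ y ∈ e', y ∈ S) then 0 else u e')).real
              (⋃ v ∈ N, ⋃ a ∈ A, openConn v a)ᶜ +
            (prodBernoulli (fun e' : Sym2 (Fin n) =>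
                if (∀ y ∈ e', y ∈ N) ∧ ¬ e'.IsDiag then 1 else if (∃ y ∈ e', y ∈ S) then 0 else u e')).real
              (⋃ v ∈ N, openConn v b) -
            (prodBernoulli (fun e' : Sym2 (Fin n) =>
                if (∀ y ∈ e', y ∈ N) ∧ ¬ e'.IsDiag then 1 else if (∃ y ∈ e', y ∈ S) then 0 else u e')).real
              (openConn e b)) := by
    refine Finset.sum_nonneg fun N hN => ?_
    obtain ⟨hNne, hNA⟩ := (Finset.mem_filter.1 hN).2
    by_cases hNx : N = ({x} : Finset (Fin n))
    · subst hNx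
      refine mul_nonneg measureReal_nonneg ?_
      rw [T_q_singleton u S x]
      simpa only [Finset.mem_singleton, Set.iUnion_iUnion_eq_left] using hx
    · rw [T_layer_weight_zero u A S N x hfree hNne hNA hNx, zero_mul]
  have h1 : (prodBernoulli (fun e' : Sym2 (Fin n) => if (∃ y ∈ e', y ∈ S) then (0 : unitInterval) else u e')).real (openConn e b) ≤ 1 := measureReal_le_one
  have h2 : 0 ≤ (prodBernoulli (fun e' : Sym2 (Fin n) => if (∀ y ∈ e', y ∈ S) ∧ ¬ e'.IsDiag then 1 else u e')).real
          {ω : BondConfig (Fin n) | ∀ y : Fin n, y ∈ (∅ : Finset (Fin n)) ↔ (y ∉ S ∧ ∃ o ∈ S, s(o, y) ∈ ω)} := measureReal_nonneg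
  nlinarith

/-- **`AdditiveGluing` for a glued block with ONE free neighbour, from `AdditiveGluing` for that neighbour in the star-killed graph**
(Kozma–Nitzan Thm 5 for blocks, in the crux's additive form; the T-form / V⁺ recursion's cost-free step).  If every positive-weight pair
from `S` to a non-relay vertex outside `S` ends at `x ∉ A ∪ S`, and the `AdditiveGluing` inequality holds for the observer `x` in the
weighting `q_∅` (`u` with the stars of `S` killed) — an instance with fewer positive-degree vertices — then it holds for the glued
block observer `S` under `u/S`. [cite: KozmaNitzan2024, Thm 5 (pp. 13–14)] -/
theorem additiveGluing_block_of_oneFree (u : Sym2 (Fin n) → unitInterval) (A S : Finset (Fin n)) (b x : Fin n)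
    (hb : b ∈ A) (hSA : Disjoint S A)
    (hfree : ∀ v ∈ S, ∀ y : Fin n, y ∉ A → y ∉ S → y ≠ x → (u s(v, y) : ℝ) = 0)
    (hAGx : ∀ t : ℝ, 0 ≤ t →
      (∀ a ∈ A, 1 - t ≤ (prodBernoulli (fun e' : Sym2 (Fin n) => if (∃ y ∈ e', y ∈ S) then (0 : unitInterval) else u e')).real (openConn a b)) →
      (prodBernoulli (fun e' : Sym2 (Fin n) => if (∃ y ∈ e', y ∈ S) then (0 : unitInterval) else u e')).real (⋃ a ∈ A, openConn x a) - t ≤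
        (prodBernoulli (fun e' : Sym2 (Fin n) => if (∃ y ∈ e', y ∈ S) then (0 : unitInterval) else u e')).real (openConn x b)) :
    ∀ t : ℝ, 0 ≤ t →
      (∀ a ∈ A, 1 - t ≤ (prodBernoulli (fun e' : Sym2 (Fin n) => if (∀ y ∈ e', y ∈ S) ∧ ¬ e'.IsDiag then 1 else u e')).real (openConn a b)) →
      (prodBernoulli (fun e' : Sym2 (Fin n) => if (∀ y ∈ e', y ∈ S) ∧ ¬ e'.IsDiag then 1 else u e')).real
          (⋃ v ∈ S, ⋃ a ∈ A, openConn v a) - t ≤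
        (prodBernoulli (fun e' : Sym2 (Fin n) => if (∀ y ∈ e', y ∈ S) ∧ ¬ e'.IsDiag then 1 else u e')).real
          (⋃ v ∈ S, openConn v b) := by
  intro t _ hA
  obtain ⟨e, he, hmin⟩ := Finset.exists_min_image A
    (fun a => (prodBernoulli (fun e' : Sym2 (Fin n) => if (∃ y ∈ e', y ∈ S) then (0 : unitInterval) else u e')).real (openConn a b)) ⟨b, hb⟩
  -- `AdditiveGluing` for `x` in `q_∅` at the level `t₀ = 1 − μ_{q_∅}(e ↔ b)` is `T_e^{q_∅}(x) ≥ 0`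
  have ht0 : 0 ≤ 1 - (prodBernoulli (fun e' : Sym2 (Fin n) => if (∃ y ∈ e', y ∈ S) then (0 : unitInterval) else u e')).real (openConn e b) := by
    linarith [(measureReal_le_one : (prodBernoulli (fun e' : Sym2 (Fin n) => if (∃ y ∈ e', y ∈ S) then (0 : unitInterval) else u e')).real (openConn e b) ≤ 1)]
  have hx' := hAGx (1 - (prodBernoulli (fun e' : Sym2 (Fin n) => if (∃ y ∈ e', y ∈ S) then (0 : unitInterval) else u e')).real (openConn e b)) ht0 (fun a ha => by linarith [hmin a ha])
  have hcx : (prodBernoulli (fun e' : Sym2 (Fin n) => if (∃ y ∈ e', y ∈ S) then (0 : unitInterval) else u e')).real (⋃ a ∈ A, openConn x a)ᶜ = 1 - (prodBernoulli (fun e' : Sym2 (Fin n) => if (∃ y ∈ e', y ∈ S) then (0 : unitInterval) else u e')).real (⋃ a ∈ A, openConn x a) := by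
    rw [measureReal_compl (MeasurableSet.of_discrete), probReal_univ]
  have hx : 0 ≤ (prodBernoulli (fun e' : Sym2 (Fin n) => if (∃ y ∈ e', y ∈ S) then (0 : unitInterval) else u e')).real (⋃ a ∈ A, openConn x a)ᶜ +
        (prodBernoulli (fun e' : Sym2 (Fin n) => if (∃ y ∈ e', y ∈ S) then (0 : unitInterval) else u e')).real (openConn x b) -
        (prodBernoulli (fun e' : Sym2 (Fin n) => if (∃ y ∈ e', y ∈ S) then (0 : unitInterval) else u e')).real (openConn e b) := by
    rw [hcx]; linarith
  have hT := T_block_nonneg_of_oneFree u A S e b x hb hSA he hmin hfree hx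
  have hc : (prodBernoulli (fun e' : Sym2 (Fin n) => if (∀ y ∈ e', y ∈ S) ∧ ¬ e'.IsDiag then 1 else u e')).real
        (⋃ v ∈ S, ⋃ a ∈ A, openConn v a)ᶜ =
      1 - (prodBernoulli (fun e' : Sym2 (Fin n) => if (∀ y ∈ e', y ∈ S) ∧ ¬ e'.IsDiag then 1 else u e')).real
        (⋃ v ∈ S, ⋃ a ∈ A, openConn v a) := by
    rw [measureReal_compl (MeasurableSet.of_discrete), probReal_univ]
  have hAe := hA e he
  rw [hc] at hT
  linarith

/-- Registered rung `stub_additiveGluingBlockOfOneFree_vp` of crux stmt-CriticalPhenomena-4576 (depth prover png-dp-vplus): Kozma–Nitzan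
Thm 5 for glued blocks in the crux's additive form — `additiveGluing_block_of_oneFree`, closed statement.
[cite: KozmaNitzan2024, Thm 5 (pp. 13–14)] -/
theorem stub_additiveGluingBlockOfOneFree_vp : ∀ (n : ℕ) (u : Sym2 (Fin n) → unitInterval) (A S : Finset (Fin n)) (b x : Fin n), b ∈ A → Disjoint S A → (∀ v ∈ S, ∀ y : Fin n, y ∉ A → y ∉ S → y ≠ x → (u s(v, y) : ℝ) = 0) → (∀ t : ℝ, 0 ≤ t → (∀ a ∈ A, 1 - t ≤ (Literature.Probability.LatticeModels.prodBernoulli (fun e' : Sym2 (Fin n) => if (∃ y ∈ e', y ∈ S) then (0 : unitInterval) else u e')).real (Literature.Probability.Percolation.openConn a b)) → (Literature.Probability.LatticeModels.prodBernoulli (fun e' : Sym2 (Fin n) => if (∃ y ∈ e', y ∈ S) then (0 : unitInterval) else u e')).real (⋃ a ∈ A, Literature.Probability.Percolation.openConn x a) - t ≤ (Literature.Probability.LatticeModels.prodBernoulli (fun e' : Sym2 (Fin n) => if (∃ y ∈ e', y ∈ S) then (0 : unitInterval) else u e')).real (Literature.Probability.Percolation.openConn x b)) → ∀ t : ℝ,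 0 ≤ t → (∀ a ∈ A, 1 - t ≤ (Literature.Probability.LatticeModels.prodBernoulli (fun e' : Sym2 (Fin n) => if (∀ y ∈ e', y ∈ S) ∧ ¬ e'.IsDiag then 1 else u e')).real (Literature.Probability.Percolation.openConn a b)) → (Literature.Probability.LatticeModels.prodBernoulli (fun e' : Sym2 (Fin n) => if (∀ y ∈ e', y ∈ S) ∧ ¬ e'.IsDiag then 1 else u e')).real (⋃ v ∈ S, ⋃ a ∈ A, Literature.Probability.Percolation.openConn v a) - t ≤ (Literature.Probability.LatticeModels.prodBernoulli (fun e' : Sym2 (Fin n) => if (∀ y ∈ e', y ∈ S) ∧ ¬ e'.IsDiag then 1 else u e')).real (⋃ v ∈ S, Literature.Probability.Percolation.openConn v b) :=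
  fun _ u A S b x hb hSA hfree hAGx => additiveGluing_block_of_oneFree u A S b x hb hSA hfree hAGx

end TBlockClasses

end

end Summit.CriticalPhenomena.PercolationContinuityZ3.Theorems
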